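import Literature.AlgebraicGeometry.ModuliOfAbelianVarieties.HodgeLociCMPoints
import Literature.AlgebraicGeometry.HodgeTheory.DirectImageBaseChangeSections
import HarnessLib

/-!
# Venture HSemireg — sheets of global classes in the étalé space, and a satisfiability witness for the
# base-chart assumption `SiegelHodgeLocusBaseChart` (`SiegelComponentChartFromFacts.lean`)

HONEST FRAMING. Companion file of the computation cell `pub-hsemireg` (theory seat 2); theorems only, no
definition, no named fact; nothing here bears on HC / HC_CM / HC_AV. `SiegelComponentChartFromFacts.lean`
derives theory seat 3's chart assumption `SiegelHodgeLocusChart g δ N` from the tree's named fact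
`deligne_globalInvariantCycles` and the BASE-LEVEL assumption `SiegelHodgeLocusBaseChart g δ N` («every
connected component `C` of the locus of Hodge classes of the universal family over `Γ_δ(N)∖𝔥_g` is swept
EXACTLY by a continuous map `τ : T(ℂ) → FiberClass D.f (2p)` over a morphism `ρ : T ⟶ D.S` from a smooth
irreducible quasi-projective `T`» — components of the Hodge locus on `𝒜_{g,δ,N}` are special subvarieties).
The red team's standing check (RED-GS A16; RED-1 v3) asks every ∀-form hypothesis to ship a satisfiability
INSTANCE or a flag. This file PROVES the instance: the clauses of `SiegelHodgeLocusBaseChart` hold — with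
`T := D.S`, `ρ := 𝟙`, `τ := globalSection Λ` — for the component of every GLOBAL class `Λ` of the universal
family that is fibrewise rational of type `(p,p)` (e.g. `Λ = 0`, or a power of the relative polarisation).
The assumption proper concerns the OTHER components (classes that are Hodge only along a proper special
subvariety), for which `T` is the connected locally symmetric variety `Γ'∖Y⁺` of Moonen–Oort §3 (d).

* `isClosed_range_globalSection`, `isOpen_range_globalSection` — when `Rᵏ f_* ℂ` is a local system on `S(ℂ)`
  (`IsCohomologicallyLocallyTrivialOn f univ`, Ehresmann — PROVED in the tree for smooth projective families
  over a smooth base) the SHEET `{(s, A|_{𝒳_s})}` of a global class `A` is closed and open in the étalé space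
  `FiberClass f k` (Voisin I §9.2.1: sections of the sheaf `Rᵏ f_* A`; two local sections agreeing at a point
  agree on a trivialising neighbourhood).
* `HodgeLocusComponent.carrier_of_globalSection_eq_range` — hence, over a preconnected base, the connected
  component of the locus of Hodge classes through a value of a flat global Hodge section IS that sheet
  (Charles–Schnell after Def. 11.3.10: a flat global `(p,p)` section makes the Hodge locus all of `S`).
* `siegelHodgeLocusBaseChart_of_globalSection` — the base-chart clauses for such components of the universal
  family of a `SiegelModuliDatum`, PROVED.

References: [VoisinHodgeI2002] §9.2.1 (with Thm. 9.3); [CharlesSchnell2014Notes] §11.3.3 (after Def. 11.3.10);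
[MoonenOort2013Torelli] §3 (d); [Hartshorne1977] II Ex. 1.13 (espace étalé).
-/

noncomputable section

open CategoryTheory AlgebraicGeometry Set
open _root_.Topology _root_.Filter
open Literature.AlgebraicTopology.SingularHomology
open Literature.AlgebraicGeometry.Motives Literature.AlgebraicGeometry.HodgeTheory
open Literature.AlgebraicGeometry.ModuliOfAbelianVarieties Literature.AlgebraicGeometry.Deligne1982

namespace Summit.Ventures.HSemireg

local notation3 (prettyPrint := false) "Res[" f ", " s ", " k ", " A "]" =>
  complexBetti.map (Literature.AlgebraicGeometry.Motives.fiberι f s) k A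

section Sheets

variable {𝒳 S : SchemeOver ℂ} (f : 𝒳 ⟶ S) (k : ℕ)

/-- **The sheet of a global class is CLOSED in the étalé space** when `Rᵏ f_* ℂ` is a local system on
`S(ℂ)`: a fibre class `x = (t, α)` off the sheet has the open sheet of a tube class `ξ` through `α` over a
trivialising `B ∋ t` as a neighbourhood, and that sheet misses the sheet of `A` (if `ξ|_s = A|_s` for one
`s ∈ B` then `ξ = A|_{f⁻¹B}` by injectivity of restriction, so `α = A|_t`). [cite: VoisinHodgeI2002, §9.2.1] -/
theorem isClosed_range_globalSection
    (hU : IsCohomologicallyLocallyTrivialOn f (Set.univ : Set (ComplexPoints S))) (A : complexBetti 𝒳 k) :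
    IsClosed (Set.range (globalSection f k A)) := by
  rw [← isOpen_compl_iff, isOpen_iff_mem_nhds]
  intro x hx
  obtain ⟨B, hBo, hxB, -, -, hbij⟩ := hU.exists_nhds_bijective (Set.mem_univ x.pt) Set.univ univ_mem
  obtain ⟨ξ, hξ⟩ := (hbij k hxB).2 x.cls
  have hxmem : x ∈ Set.range (tubeSection f k B ξ) := by
    refine ⟨⟨x.pt, hxB⟩, ?_⟩
    change (⟨x.pt, fiberRestrict f hxB k ξ⟩ : FiberClass f k) = x
    rw [hξ]
  refine Filter.mem_of_superset ((isOpen_range_tubeSection f k hU hBo (Set.subset_univ _) ξ).mem_nhds hxmem) ?_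
  rintro _ ⟨⟨s, hsB⟩, rfl⟩ ⟨t, ht⟩
  -- `ht : globalSection f k A t = tubeSection f k B ξ ⟨s, hsB⟩`
  have hts : t = s := congrArg FiberClass.pt ht
  subst hts
  have hcls : complexBetti.map (fiberι f t) k A = fiberRestrict f hsB k ξ := (FiberClass.mk_eq_mk_iff _ _).1 ht
  have hξA : restrictTube f B k A = ξ :=
    (hbij k hsB).1 (by rw [fiberRestrict_restrictTube_apply, hcls])
  refine hx ⟨x.pt, ?_⟩
  change (⟨x.pt, complexBetti.map (fiberι f x.pt) k A⟩ : FiberClass f k) = x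
  rw [← fiberRestrict_restrictTube_apply f hxB k A, hξA, hξ]

/-- **The sheet of a global class is OPEN in the étalé space** (it is the sheet of the tube class
`A|_{f⁻¹S(ℂ)}` over the open `S(ℂ)`). [cite: VoisinHodgeI2002, §9.2.1] -/
theorem isOpen_range_globalSection
    (hU : IsCohomologicallyLocallyTrivialOn f (Set.univ : Set (ComplexPoints S))) (A : complexBetti 𝒳 k) :
    IsOpen (Set.range (globalSection f k A)) := by
  have hr : Set.range (globalSection f k A) =
      Set.range (tubeSection f k Set.univ (restrictTube f Set.univ k A)) := by
    rw [globalSection_eq_tubeSection_comp, Set.range_comp]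
    have hs : Set.range (fun s : ComplexPoints S => (⟨s, Set.mem_univ s⟩ : (Set.univ : Set (ComplexPoints S)))) =
        Set.univ := by
      rw [Set.eq_univ_iff_forall]
      rintro ⟨s, hs⟩
      exact ⟨s, rfl⟩
    rw [hs, Set.image_univ]
  rw [hr]
  exact isOpen_range_tubeSection f k hU isOpen_univ subset_rfl _

/-- **A component of the locus of Hodge classes containing a value of a flat global Hodge section IS the
sheet of that section**: the sheet is clopen and connected, meets the component, and lies in the locus.
[cite: CharlesSchnell2014Notes, §11.3.3 (after Def. 11.3.10)] -/
theorem HodgeLocusComponent.carrier_of_globalSection_eq_range {n p : ℕ}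
    (hU : IsCohomologicallyLocallyTrivialOn f (Set.univ : Set (ComplexPoints S)))
    [PreconnectedSpace (ComplexPoints S)] {A : complexBetti 𝒳 (2 * p)}
    (hA : ∀ s, globalSection f (2 * p) A s ∈ locusOfHodgeClasses f n p) (s : ComplexPoints S) :
    (HodgeLocusComponent.of (globalSection f (2 * p) A s) (hA s)).carrier =
      Set.range (globalSection f (2 * p) A) := by
  rw [HodgeLocusComponent.carrier_of]
  refine Set.Subset.antisymm ?_ (range_globalSection_subset_connectedComponentIn hA s)
  exact isPreconnected_connectedComponentIn.subset_isClopen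
    ⟨isClosed_range_globalSection f _ hU A, isOpen_range_globalSection f _ hU A⟩
    ⟨_, mem_connectedComponentIn (hA s), Set.mem_range_self s⟩

end Sheets

section Witness

variable {g : ℕ} {δ : Fin g → ℕ} {N : ℕ}

/-- **Satisfiability witness for the base chart: components of GLOBAL classes.** For a global class `Λ` of the
universal family that is fibrewise rational of type `(p,p)` (e.g. a power of the relative polarisation, or `0`),
the component of the locus of Hodge classes through `(s₀, Λ|_{𝒴_{s₀}})` is the sheet of `Λ` over the whole
(preconnected) base, so the base chart holds for it with `T := D.S`, `ρ := 𝟙`, `τ := globalSection Λ` — the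
clauses of `SiegelHodgeLocusBaseChart` for this `C`, PROVED (no assumption). [folklore] -/
theorem siegelHodgeLocusBaseChart_of_globalSection (D : SiegelModuliDatum g δ N) (p : ℕ)
    (Λ : complexBetti D.𝒳 (2 * p))
    (hΛ : ∀ s : ComplexPoints D.S, IsRationalClass (Res[D.f, s, 2 * p, Λ]) ∧
      IsOfHodgeType g (fiberOver D.f s) (2 * p) p p (Res[D.f, s, 2 * p, Λ]))
    (s₀ : ComplexPoints D.S) :
    ∃ (T : SchemeOver ℂ) (ρ : T ⟶ D.S) (τ : ComplexPoints T → FiberClass D.f (2 * p)),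
      IsQuasiProjectiveOver T ∧ _root_.AlgebraicGeometry.Smooth T.hom ∧ IrreducibleSpace T.left ∧
      Continuous τ ∧ (∀ u : ComplexPoints T, (τ u).pt = AlgPoints.map ρ u) ∧
      Set.range τ = (HodgeLocusComponent.of (globalSection D.f (2 * p) Λ s₀)
        (globalSection_mem_locusOfHodgeClasses (hΛ s₀).1 (hΛ s₀).2)).carrier := by
  haveI : _root_.AlgebraicGeometry.Smooth D.S.hom := D.smooth_base
  haveI := D.preconnectedSpace_complexPoints
  have hA : ∀ s, globalSection D.f (2 * p) Λ s ∈ locusOfHodgeClasses D.f g p := fun s =>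
    globalSection_mem_locusOfHodgeClasses (hΛ s).1 (hΛ s).2
  refine ⟨D.S, 𝟙 D.S, globalSection D.f (2 * p) Λ, D.isQuasiProjectiveOver_base, D.smooth_base,
    D.irreducibleSpace_base, continuous_globalSection D.f (2 * p) Λ, fun u => (AlgPoints.map_id_apply u).symm, ?_⟩
  rw [HodgeLocusComponent.carrier_of_globalSection_eq_range D.f
    (isCohomologicallyLocallyTrivialOn_univ_of_isSmoothProjectiveFamily_of_smooth D.f D.isSmoothProjectiveFamily)
    hA s₀]

end Witness

end Summit.Ventures.HSemireg

end
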